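import Mathlib

/-!
# Schur complements: restriction, block inverse and the quotient property

The exact block-matrix algebra of Schur complements used by partial rank-revealing LU /
tensor cross interpolation (Núñez Fernández et al. 2025, §3.2) and recorded in Horn–Johnson,
*Matrix Analysis* (2nd ed.), §0.8.5.  For a block matrix `A = fromBlocks P B C D` whose leading
block `P` is nonsingular, the Schur complement of `P` in `A` is `[A/P] = D - C P⁻¹ B`
(`schurCompl P B C D`; Mathlib's nonsingular inverse `P⁻¹`).  We prove, over a commutative ring:

* `submatrix_schurCompl`, `schurCompl_fromCols_fromRows_fromBlocks` — RESTRICTION: a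
  restriction of `[A/P]` to some rows and columns is the Schur complement of `P` in the
  correspondingly restricted matrix; in particular `[A/P]` of a `3 × 3` block matrix is the
  `2 × 2` block matrix of the Schur complements of `P` in the four `2 × 2` block submatrices
  containing `P` [NunezFernandezEtAl2025, §3.2.5];
* `det_fromBlocks_eq_det_mul_det_schurCompl`, `isUnit_det_fromBlocks_iff` — the Schur
  determinant identity `det A = det P · det [A/P]` in this notation (Mathlib's
  `Matrix.det_fromBlocks₁₁`) [HornJohnson2013, §0.8.5 (c)]; [NunezFernandezEtAl2025, §3.2.1];
* `schurCompl_apply_mul_det` — every entry of `[A/P]` is a ratio of minors of `A`: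
  `[A/P] i j · det P = det (A restricted to the pivot block bordered by row i and column j)`
  [HornJohnson2013, §0.8.5 (0.8.5.4)];
* `inv_fromBlocks_of_isUnit_det` — the block (Banachiewicz) inverse of `A` in terms of `P⁻¹`
  and `[A/P]⁻¹` when both are nonsingular [HornJohnson2013, §0.8.5 (0.8.5.6)], and
  `toBlocks₂₂_inv_fromBlocks` — `(A⁻¹)₂₂ = [A/P]⁻¹` [NunezFernandezEtAl2025, §3.2.1];
  [HornJohnson2013, §0.8.5 (0.8.5.6)];
* `schurCompl_submatrix_equiv` — permutations inside the eliminated block commute with the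
  elimination [NunezFernandezEtAl2025, §3.2.2];
* `schurCompl_quotient`, `schurCompl_quotient₂₂` — the QUOTIENT PROPERTY (Crabtree–Haynsworth):
  for a `3 × 3` block matrix `A = (Aᵢⱼ)` with `B = fromBlocks A₁₁ A₁₂ A₂₁ A₂₂` its leading
  `2 × 2` block submatrix, `[A/B] = [[A/A₁₁] / [B/A₁₁]]` when `A₁₁` and `[B/A₁₁]` are
  nonsingular, and `[A/B] = [[A/A₂₂] / [B/A₂₂]]` when `A₂₂` and `[B/A₂₂]` are
  [HornJohnson2013, §0.8.5 (0.8.5.12)]; [NunezFernandezEtAl2025, §3.2.2] — successive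
  elimination of blocks in any order and grouping gives the same Schur complement, which is why
  an iterated (one-pivot-at-a-time) elimination such as prrLU computes the Schur complement of
  the whole pivot matrix, i.e. the error of the cross interpolation
  (`Literature.LinearAlgebra.Matrix.fromBlocks_sub_crossInterp`).

Already in Mathlib and only re-dressed here: the block `LDU` factorisation
`Matrix.fromBlocks_eq_of_invertible₁₁`, `Matrix.det_fromBlocks₁₁`, and the `⅟`-form of the
block inverse `Matrix.invOf_fromBlocks₁₁_eq`.  Not formalised: positivity-preserving properties,
inertia additivity, or anything approximate.

References: R. A. Horn, C. R. Johnson, *Matrix Analysis*, 2nd ed., CUP 2013, §0.8.5;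
Y. Núñez Fernández et al., *Learning tensor networks with tensor cross interpolation: new
algorithms and libraries*, SciPost Phys. 18 (2025) 104, arXiv:2407.02454, §3.2 (the quotient
property is attributed there to Crabtree and Haynsworth).
AI-produced formalisation (H21 engines group, seat eng-quad-2, 2026-08-21); no facts, no axioms
beyond Mathlib's, no `sorry`.
-/

open Matrix

namespace Literature.LinearAlgebra.Matrix

variable {K : Type*} [CommRing K]
variable {ι κ m n m' n' : Type*} [Fintype ι] [DecidableEq ι]

/-- [cite: HornJohnson2013, §0.8.5 (0.8.5.3)]; [cite: NunezFernandezEtAl2025, §3.2.1]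
The Schur complement `[A/P] = D - C P⁻¹ B` of the nonsingular leading block `P` in the block
matrix `A = fromBlocks P B C D` (`P⁻¹` is Mathlib's nonsingular inverse; the theorems below
assume `IsUnit P.det` where it matters). -/
noncomputable def schurCompl (P : Matrix ι ι K) (B : Matrix ι n K) (C : Matrix m ι K)
    (D : Matrix m n K) : Matrix m n K :=
  D - C * P⁻¹ * B

/-- [cite: NunezFernandezEtAl2025, §3.2.1] Unfolding lemma for `schurCompl`. -/
theorem schurCompl_def (P : Matrix ι ι K) (B : Matrix ι n K) (C : Matrix m ι K)
    (D : Matrix m n K) : schurCompl P B C D = D - C * P⁻¹ * B := rfl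

/-! ## Restriction -/

/-- [cite: NunezFernandezEtAl2025, §3.2.5] RESTRICTION PROPERTY: restricting the Schur
complement `[A/P]` to rows `r` and columns `c` gives the Schur complement of `P` in the matrix
`A` restricted to those rows and columns (plus the pivot block). -/
theorem submatrix_schurCompl (P : Matrix ι ι K) (B : Matrix ι n K) (C : Matrix m ι K)
    (D : Matrix m n K) (r : m' → m) (c : n' → n) :
    (schurCompl P B C D).submatrix r c =
      schurCompl P (B.submatrix id c) (C.submatrix r id) (D.submatrix r c) := by
  ext i j
  simp [schurCompl, Matrix.mul_apply]

/-- [cite: NunezFernandezEtAl2025, §3.2.5] RESTRICTION PROPERTY, block form: the Schur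
complement of `P` in the `3 × 3` block matrix
`fromBlocks P (fromCols B₁ B₂) (fromRows C₁ C₂) (fromBlocks D₁₁ D₁₂ D₂₁ D₂₂)` is the `2 × 2`
block matrix of the Schur complements of `P` in the four `2 × 2` block submatrices containing
`P`. -/
theorem schurCompl_fromCols_fromRows_fromBlocks (P : Matrix ι ι K) (B₁ : Matrix ι n K)
    (B₂ : Matrix ι n' K) (C₁ : Matrix m ι K) (C₂ : Matrix m' ι K) (D₁₁ : Matrix m n K)
    (D₁₂ : Matrix m n' K) (D₂₁ : Matrix m' n K) (D₂₂ : Matrix m' n' K) :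
    schurCompl P (fromCols B₁ B₂) (fromRows C₁ C₂) (fromBlocks D₁₁ D₁₂ D₂₁ D₂₂) =
      fromBlocks (schurCompl P B₁ C₁ D₁₁) (schurCompl P B₂ C₁ D₁₂) (schurCompl P B₁ C₂ D₂₁)
        (schurCompl P B₂ C₂ D₂₂) := by
  ext (i | i) (j | j) <;> simp [schurCompl, Matrix.mul_apply]

/-- [cite: NunezFernandezEtAl2025, §3.2.2] PERMUTATION INVARIANCE: re-indexing the rows and
columns of the pivot block (rows of `B` and columns of `C` accordingly) does not change the
Schur complement — permutations inside the eliminated block can be taken before or after the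
elimination. -/
theorem schurCompl_submatrix_equiv {ι' : Type*} [Fintype ι'] [DecidableEq ι']
    (P : Matrix ι ι K) (B : Matrix ι n K) (C : Matrix m ι K) (D : Matrix m n K)
    (e f : ι' ≃ ι) :
    schurCompl (P.submatrix e f) (B.submatrix e id) (C.submatrix id f) D =
      schurCompl P B C D := by
  rw [schurCompl, schurCompl, inv_submatrix_equiv, submatrix_mul_equiv,
    submatrix_mul_equiv, submatrix_id_id]

/-! ## Determinant -/

section Det

variable [Fintype m] [DecidableEq m]

/-- [cite: HornJohnson2013, §0.8.5 (c)]; [cite: NunezFernandezEtAl2025, §3.2.1]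
SCHUR DETERMINANT IDENTITY `det A = det P · det [A/P]` for a nonsingular leading block `P`
(Mathlib's `Matrix.det_fromBlocks₁₁`, restated with the nonsingular inverse). -/
theorem det_fromBlocks_eq_det_mul_det_schurCompl (P : Matrix ι ι K) (B : Matrix ι m K)
    (C : Matrix m ι K) (D : Matrix m m K) (hP : IsUnit P.det) :
    (fromBlocks P B C D).det = P.det * (schurCompl P B C D).det := by
  letI := Matrix.invertibleOfIsUnitDet P hP
  rw [det_fromBlocks₁₁, invOf_eq_nonsing_inv, schurCompl]

/-- [cite: HornJohnson2013, §0.8.5 (c)] For a nonsingular leading block `P`, the block matrix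
`A` is nonsingular iff the Schur complement `[A/P]` is. -/
theorem isUnit_det_fromBlocks_iff (P : Matrix ι ι K) (B : Matrix ι m K) (C : Matrix m ι K)
    (D : Matrix m m K) (hP : IsUnit P.det) :
    IsUnit (fromBlocks P B C D).det ↔ IsUnit (schurCompl P B C D).det := by
  rw [det_fromBlocks_eq_det_mul_det_schurCompl P B C D hP, IsUnit.mul_iff, and_iff_right hP]

end Det

/-- [cite: HornJohnson2013, §0.8.5 (0.8.5.4)] ENTRIES OF THE SCHUR COMPLEMENT ARE RATIOS OF
MINORS: `[A/P] i j · det P` is the determinant of the pivot block `P` bordered by the `i`-th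
row and `j`-th column of `A` (the `(k+1) × (k+1)` minor `det A[α ∪ {i}, α ∪ {j}]`). -/
theorem schurCompl_apply_mul_det (P : Matrix ι ι K) (B : Matrix ι n K) (C : Matrix m ι K)
    (D : Matrix m n K) (hP : IsUnit P.det) (i : m) (j : n) :
    schurCompl P B C D i j * P.det =
      (fromBlocks P (B.submatrix id fun _ : Unit => j) (C.submatrix (fun _ : Unit => i) id)
        (D.submatrix (fun _ : Unit => i) fun _ : Unit => j)).det := by
  rw [det_fromBlocks_eq_det_mul_det_schurCompl _ _ _ _ hP, ← submatrix_schurCompl,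
    det_unique ((schurCompl P B C D).submatrix _ _)]
  simp [mul_comm]

/-! ## Block inverse -/

section Inverse

variable [Fintype m] [DecidableEq m]

/-- [cite: HornJohnson2013, §0.8.5 (0.8.5.6)] BLOCK INVERSE (Banachiewicz): if `P` and the
Schur complement `S = [A/P]` are nonsingular then
`A⁻¹ = fromBlocks (P⁻¹ + P⁻¹ B S⁻¹ C P⁻¹) (-P⁻¹ B S⁻¹) (-S⁻¹ C P⁻¹) S⁻¹`
(Mathlib's `Matrix.invOf_fromBlocks₁₁_eq`, restated with nonsingular inverses). -/
theorem inv_fromBlocks_of_isUnit_det (P : Matrix ι ι K) (B : Matrix ι m K) (C : Matrix m ι K)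
    (D : Matrix m m K) (hP : IsUnit P.det) (hS : IsUnit (schurCompl P B C D).det) :
    (fromBlocks P B C D)⁻¹ =
      fromBlocks (P⁻¹ + P⁻¹ * B * (schurCompl P B C D)⁻¹ * C * P⁻¹)
        (-(P⁻¹ * B * (schurCompl P B C D)⁻¹)) (-((schurCompl P B C D)⁻¹ * C * P⁻¹))
        (schurCompl P B C D)⁻¹ := by
  letI := Matrix.invertibleOfIsUnitDet P hP
  have hS' : IsUnit (D - C * ⅟P * B).det := by rwa [invOf_eq_nonsing_inv]
  letI := Matrix.invertibleOfIsUnitDet _ hS'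
  letI := fromBlocks₁₁Invertible P B C D
  rw [← invOf_eq_nonsing_inv (fromBlocks P B C D), invOf_fromBlocks₁₁_eq]
  simp only [invOf_eq_nonsing_inv, schurCompl]

/-- [cite: NunezFernandezEtAl2025, §3.2.1]; [cite: HornJohnson2013, §0.8.5 (0.8.5.6)]
`(A⁻¹)₂₂ = [A/P]⁻¹`: the trailing block of the inverse is the inverse of the Schur
complement. -/
theorem toBlocks₂₂_inv_fromBlocks (P : Matrix ι ι K) (B : Matrix ι m K) (C : Matrix m ι K)
    (D : Matrix m m K) (hP : IsUnit P.det) (hS : IsUnit (schurCompl P B C D).det) :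
    ((fromBlocks P B C D)⁻¹).toBlocks₂₂ = (schurCompl P B C D)⁻¹ := by
  rw [inv_fromBlocks_of_isUnit_det P B C D hP hS, toBlocks_fromBlocks₂₂]

end Inverse

/-! ## The quotient property -/

/-- [cite: HornJohnson2013, §0.8.5 (0.8.5.12)]; [cite: NunezFernandezEtAl2025, §3.2.2]
QUOTIENT PROPERTY OF SCHUR COMPLEMENTS (Crabtree–Haynsworth).  Let `A = (Aᵢⱼ)_{i,j ≤ 3}` be a
`3 × 3` block matrix and `B = fromBlocks A₁₁ A₁₂ A₂₁ A₂₂` its leading `2 × 2` block submatrix,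
with `A₁₁` and `[B/A₁₁]` nonsingular (hence `B` nonsingular).  Then `[A/B] = [[A/A₁₁]/[B/A₁₁]]`,
where `[A/A₁₁]` is the `2 × 2` block matrix of Schur complements of `A₁₁`
(`schurCompl_fromCols_fromRows_fromBlocks`) whose leading block is `[B/A₁₁]`: eliminating the
blocks `A₁₁` and then `[B/A₁₁]` one after the other gives the same result as eliminating `B` at
once. -/
theorem schurCompl_quotient [Fintype κ] [DecidableEq κ] (A₁₁ : Matrix ι ι K)
    (A₁₂ : Matrix ι κ K) (A₁₃ : Matrix ι n K) (A₂₁ : Matrix κ ι K) (A₂₂ : Matrix κ κ K)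
    (A₂₃ : Matrix κ n K) (A₃₁ : Matrix m ι K) (A₃₂ : Matrix m κ K) (A₃₃ : Matrix m n K)
    (h₁ : IsUnit A₁₁.det) (h₂ : IsUnit (schurCompl A₁₁ A₁₂ A₂₁ A₂₂).det) :
    schurCompl (fromBlocks A₁₁ A₁₂ A₂₁ A₂₂) (fromRows A₁₃ A₂₃) (fromCols A₃₁ A₃₂) A₃₃ =
      schurCompl (schurCompl A₁₁ A₁₂ A₂₁ A₂₂) (schurCompl A₁₁ A₁₃ A₂₁ A₂₃)
        (schurCompl A₁₁ A₁₂ A₃₁ A₃₂) (schurCompl A₁₁ A₁₃ A₃₁ A₃₃) := by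
  set S := schurCompl A₁₁ A₁₂ A₂₁ A₂₂ with hS
  rw [schurCompl_def (fromBlocks A₁₁ A₁₂ A₂₁ A₂₂), inv_fromBlocks_of_isUnit_det _ _ _ _ h₁ h₂,
    ← hS, fromCols_mul_fromBlocks, fromCols_mul_fromRows]
  simp only [schurCompl_def A₁₁, schurCompl_def S, Matrix.mul_add, Matrix.add_mul,
    Matrix.mul_sub, Matrix.sub_mul, Matrix.mul_neg, Matrix.neg_mul, Matrix.mul_assoc]
  abel

/-- [cite: NunezFernandezEtAl2025, §3.2.2]; [cite: HornJohnson2013, §0.8.5 (0.8.5.12)]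
QUOTIENT PROPERTY, second form: with `A₂₂` and `[B/A₂₂]` nonsingular,
`[A/B] = [[A/A₂₂]/[B/A₂₂]]` — eliminating the block `A₂₂` first and then `[B/A₂₂]` gives the
same Schur complement as eliminating `A₁₁` first (`schurCompl_quotient`) or `B` at once; here
`[B/A₂₂] = A₁₁ - A₁₂ A₂₂⁻¹ A₂₁ = schurCompl A₂₂ A₂₁ A₁₂ A₁₁` and `[A/A₂₂]` is written blockwise. -/
theorem schurCompl_quotient₂₂ [Fintype κ] [DecidableEq κ] (A₁₁ : Matrix ι ι K)
    (A₁₂ : Matrix ι κ K) (A₁₃ : Matrix ι n K) (A₂₁ : Matrix κ ι K) (A₂₂ : Matrix κ κ K)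
    (A₂₃ : Matrix κ n K) (A₃₁ : Matrix m ι K) (A₃₂ : Matrix m κ K) (A₃₃ : Matrix m n K)
    (h₁ : IsUnit A₂₂.det) (h₂ : IsUnit (schurCompl A₂₂ A₂₁ A₁₂ A₁₁).det) :
    schurCompl (fromBlocks A₁₁ A₁₂ A₂₁ A₂₂) (fromRows A₁₃ A₂₃) (fromCols A₃₁ A₃₂) A₃₃ =
      schurCompl (schurCompl A₂₂ A₂₁ A₁₂ A₁₁) (schurCompl A₂₂ A₂₃ A₁₂ A₁₃)
        (schurCompl A₂₂ A₂₁ A₃₂ A₃₁) (schurCompl A₂₂ A₂₃ A₃₂ A₃₃) := by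
  have e₁ : (fromBlocks A₁₁ A₁₂ A₂₁ A₂₂).submatrix (Equiv.sumComm κ ι) (Equiv.sumComm κ ι) =
      fromBlocks A₂₂ A₂₁ A₁₂ A₁₁ := by
    ext (i | i) (j | j) <;> simp
  have e₂ : (fromRows A₁₃ A₂₃).submatrix (Equiv.sumComm κ ι) id = fromRows A₂₃ A₁₃ := by
    ext (i | i) j <;> simp
  have e₃ : (fromCols A₃₁ A₃₂).submatrix id (Equiv.sumComm κ ι) = fromCols A₃₂ A₃₁ := by
    ext i (j | j) <;> simp
  rw [← schurCompl_quotient A₂₂ A₂₁ A₂₃ A₁₂ A₁₁ A₁₃ A₃₂ A₃₁ A₃₃ h₁ h₂, ← e₁, ← e₂, ← e₃,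
    schurCompl_submatrix_equiv]

end Literature.LinearAlgebra.Matrix
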